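import Summits.ABC.IUTFork.Joshi.ATS4LogDiffConductorTame
import Summits.ABC.IUTFork.Joshi.ATS4LogDiffConductorTauGalois
import Literature.NumberTheory.NumberFields.DedekindDifferentBoundGeneral
import HarnessLib

/-!
# Joshi, *Arithmetic Teichmüller Spaces IV* (arXiv:2403.10430v2) Thm. 4.6.1 (1), eq. (4.6.4): the typed `TauBounds`
# — PROVED for EVERY extension of number fields (the non-Galois upper bound `τ_{w|v} ≤ e_{w|v}·ord_v(e_{w|v})`)

Proof-only companion of `Joshi/ATS4LogDiffConductor.lean` (abc-iut cell; branch-C seat abc-iut-w6-d109 for branch E, rung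
LADDER-ABC:A2.E; consumer files of abc-iut-E-t27: `ATS4LogDiffConductorTame.lean`, `…TauGalois.lean`, `…Decided.lean`).
**No side is taken** on [IUTchIII] Cor. 3.12, on Joshi's claims, or on Mochizuki's reports on them; the source is an unrefereed
arXiv preprint; the mathematics discharged here is classical (Dedekind–Hensel).

abc-iut-E-t27 proved the typed claim `LogDiffCond.TauBounds L M` ([J-IV] (4.6.4) p.47 l.20–24 «τ_{w|v} = 0 iff w|v is at worst
tamely ramified … τ_{w|v} ∈ [1, e_{w|v}·ord_v(e_{w|v})] if w|v is wildly ramified»; [Bombieri–Gubler 2006, B.2.12]) for GALOIS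
`M/L` (`tauBounds_of_isGalois`) and left «the general (non-Galois) upper bound of B.2.12 / Hensel» as the typed hypothesis. That
bound is now the tree's `Literature.NumberTheory.NumberFields.multiplicity_differentIdeal_succ_le`
(`DedekindDifferentBoundGeneral.lean`: `ord_w 𝔡_{M/L} + 1 ≤ e_{w|v} + ord_w((e_{w|v}))` for EVERY `M/L`, proved globally through
the inertia fields of a Galois closure). Here:

* `tau_le` — `τ_{w|v} ≤ e_{w|v}·ord_v(e_{w|v})` at every prime `w` of every extension `M/L` (the tree bound + abc-iut-E-t27's
  extension law `ordIdeal_span_natCast_eq_mul`: `ord_w((n)·𝓞_M) = e_{w|v}·ord_v((n)·𝓞_L)`);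
* **`tauBounds_holds : TauBounds L M`** — the typed hypothesis of `ATS4LogDiffConductor.lean` is a THEOREM for every `M/L`
  (with abc-iut-E-t27's `tau_eq_zero_iff_isTameAt`, `one_le_tau_of_not_isTameAt`).

Theorems only; standard axioms; no `sorry`, instance, notation or new `Prop` fact. [claim: Joshi2024ATS4, status: disputed]
(provenance of the typed item; nothing endorsed).
-/

noncomputable section

namespace Summit.ABC.IUTFork.Joshi.ATS4

namespace LogDiffCond

open NumberField IsDedekindDomain Ideal Module UniqueFactorizationMonoid
open Literature.NumberTheory.NumberFields (multiplicity_differentIdeal_succ_le)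

variable (L M : Type*) [Field L] [NumberField L] [Field M] [NumberField M] [Algebra L M]

omit [NumberField L] in
/-- `e_{w|v}`: Mathlib `ramificationIdx'` over `w ∩ 𝓞_L` = `Ideal.ramificationIdx` over `𝓞_L` (private copy of abc-iut-E-t27's
`relRamIdx_eq`). [folklore] -/
private theorem relRamIdx_eq'' (w : HeightOneSpectrum (𝓞 M)) : relRamIdx L M w = w.asIdeal.ramificationIdx (𝓞 L) := by
  haveI := w.isPrime
  exact Ideal.ramificationIdx'_eq_ramificationIdx (w.asIdeal.under (𝓞 L)) w.asIdeal (w.under (𝓞 L)).ne_bot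

/-- `ordIdeal` is Mathlib's `multiplicity` for a nonzero ideal (private copy of abc-iut-E-t27's `ordIdeal_eq_multiplicity`).
[folklore] -/
private theorem ordIdeal_eq_multiplicity'' (M : Type*) [Field M] [NumberField M] (w : HeightOneSpectrum (𝓞 M))
    {I : Ideal (𝓞 M)} (hI : I ≠ ⊥) : ordIdeal w I = multiplicity w.asIdeal I := by
  classical
  rw [ordIdeal, Ideal.count_associates_factors_eq hI w.isPrime w.ne_bot,
    UniqueFactorizationMonoid.multiplicity_eq_count_normalizedFactors w.irreducible hI, normalize_eq]

/-- **[J-IV] (4.6.4), upper bound — PROVED for every extension `M/L` of number fields**: `τ_{w|v} ≤ e_{w|v}·ord_v(e_{w|v})`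
at every prime `w` of `M` (p.47 l.20–24; Dedekind–Hensel `ord_w 𝔡_{M/L} ≤ e − 1 + ord_w((e))`, the tree's
`multiplicity_differentIdeal_succ_le`, plus the extension law `ord_w((e)·𝓞_M) = e_{w|v}·ord_v((e)·𝓞_L)`).
[cite: BombieriGubler2006, Thm B.2.12] -/
theorem tau_le (w : HeightOneSpectrum (𝓞 M)) :
    tau L M w ≤ relRamIdx L M w * ordIdeal (w.under (𝓞 L)) (Ideal.span {((relRamIdx L M w : ℕ) : 𝓞 L)}) := by
  haveI := w.isMaximal
  have he0 : relRamIdx L M w ≠ 0 := by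
    rw [relRamIdx_eq'']; exact (Ideal.ramificationIdx_pos w.asIdeal (𝓞 L)).ne'
  rw [← ordIdeal_span_natCast_eq_mul L M w he0]
  have h := multiplicity_differentIdeal_succ_le L M w.asIdeal
  have hspan : Ideal.span {((w.asIdeal.ramificationIdx (𝓞 L) : ℕ) : 𝓞 M)} ≠ ⊥ := by
    rw [Ne, Ideal.span_singleton_eq_bot, Nat.cast_eq_zero, ← relRamIdx_eq'']; exact he0
  have hD : differentIdeal (𝓞 L) (𝓞 M) ≠ ⊥ := differentIdeal_ne_bot
  rw [relRamIdx_eq'', ordIdeal_eq_multiplicity'' M w hspan, tau, relDiffExp, ordIdeal_eq_multiplicity'' M w hD,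
    relRamIdx_eq'']
  omega

/-- **The typed `TauBounds` ((4.6.4): «τ = 0 iff tame; 1 ≤ τ ≤ e·ord_v(e) if wild») is a THEOREM for every extension of
number fields `M/L`** — abc-iut-E-t27's `tau_eq_zero_iff_isTameAt` and `one_le_tau_of_not_isTameAt` (Serre III §6 Prop. 13)
with `tau_le` (Dedekind–Hensel, general case). Supersedes `tauBounds_of_isGalois` (Galois hypothesis dropped).
[cite: BombieriGubler2006, Thm B.2.12] -/
theorem tauBounds_holds : TauBounds L M := fun w =>
  ⟨tau_eq_zero_iff_isTameAt L M w, fun hw => ⟨one_le_tau_of_not_isTameAt L M w hw, tau_le L M w⟩⟩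

end LogDiffCond

end Summit.ABC.IUTFork.Joshi.ATS4

end
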